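import Summits.KontsevichZagierPeriods.KontsevichZagierPeriods.Theses.LinRedNormalForm
import Summits.KontsevichZagierPeriods.KontsevichZagierPeriods.Theorems.LinRedNormalFormHoffmanIndependenceGradingIndep
import Summits.KontsevichZagierPeriods.KontsevichZagierPeriods.Theorems.LinRedNormalFormHoffmanIndependenceHoffmanBasis
import Summits.KontsevichZagierPeriods.KontsevichZagierPeriods.Theorems.LinRedNormalFormHoffmanIndependenceKernelElement
import Summits.KontsevichZagierPeriods.KontsevichZagierPeriods.Theorems.LinRedNormalFormHoffmanIndependenceFinrankFiltered
import Summits.KontsevichZagierPeriods.KontsevichZagierPeriods.Theorems.LinRedNormalFormHoffmanIndependenceFinrankLe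

/-!
# Crux `HoffmanIndependence` (stmt-KontsevichZagierPeriods-15045), line `Sketch` — the transfer:
# prime-ideal amplification over Brown's motivic MZVs, and the crux from the counting statement

The composition of line `Sketch` (card `simultaneous-pade-amplification`, crux-ideate round 1),
sorry-free, assembled from the five landed stubs (`stub_gradingIndep`, `stub_hoffmanBasis`,
`stub_kernelElement`, `stub_finrankFiltered`, `stub_finrankLeOfKernelElement`).

* `finrank_hoffmanSpan_le_of_relation` — **amplification inequality**, unconditional over the
  bundle: for Brown's motivic MZVs `M : Brown2012.MotivicMZV` with `H` an integral domain, ONE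
  non-trivial `ℚ`-relation among real Hoffman values `ζ(u)`, `u ∈ {2,3}^×` of weight `≤ N`, forces
  `dim_ℚ ⨆_{k≤K} hoffmanSpan k ≤ d_{≤K} - d_{≤K-N}` for EVERY `K ≥ N` (`d_{≤K} = ∑_{k≤K} d_k`,
  `d_k = zagierDim k`): the relation lifts to a non-zero `R ∈ ker per ∩ H_{≤N}` (Brown 2012 Thm 7.4:
  the motivic Hoffman elements are a basis), and `R · H_{≤K-N} ↪ ker per ∩ H_{≤K}` because `per`
  is a ring homomorphism out of a domain — a deficit of the fixed proportion `≈ ρ^{-N}` (`ρ` the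
  plastic number) at every level.
* `crux_of_amplification`, `crux_of_density` — contrapositive: the asymptotic counting statement
  `C⁺ : ∀ N, ∃ K ≥ N, d_{≤K} - d_{≤K-N} < dim_ℚ ⨆_{k≤K} hoffmanSpan k` implies the `ℚ`-linear
  independence of all real Hoffman values (the crux, unfolded), over any such `M`.
* `hoffmanIndependence_of_denseCount` — the same with the conclusion BY NAME
  (`Theses.LinRedNormalForm.HoffmanIndependence`): a CONDITIONAL result, hypotheses = existence of
  Brown's objects with `H` a domain (theorem in print, XL debt, D-0026 bundle) and `C⁺` (open,
  crux-equivalent: the crux gives `C⁺` with `K = N`).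

No new definitions. This file does not close the item: the crux is a declared open transcendence
input (Zagier-conjecture strength); the line lands the transfer `C⁺ → crux` and stops there.
-/

noncomputable section

namespace Summit.KontsevichZagierPeriods.LinRedNormalForm.HoffmanIndependence

open Literature.NumberTheory.Transcendental MZV Brown2012
open Summit.KontsevichZagierPeriods.KontsevichZagierPeriods.Theses.LinRedNormalForm (HoffmanIndependence)

/-- **Amplification inequality** (card `simultaneous-pade-amplification`, transfer; unconditional
over the bundle): for Brown's motivic MZVs `M` with `H` a domain, ONE non-trivial `ℚ`-relation of
weight `≤ N` among real Hoffman values forces `dim_ℚ ⨆_{k≤K} hoffmanSpan k ≤ d_{≤K} - d_{≤K-N}`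
for every `K ≥ N` — a deficit of the fixed proportion `≈ ρ^{-N}` (`ρ` the plastic number) at
every level. The grading, dimension and Hoffman-basis facts are theorems of the bundle
(`stub_gradingIndep`, `stub_hoffmanBasis`: Brown 2012 (2.15), (7.2), Thm 7.4); then the kernel
element (`stub_kernelElement`), `dim H_{≤K} = d_{≤K}` (`stub_finrankFiltered`) and rank–nullity
(`stub_finrankLeOfKernelElement`). -/
theorem finrank_hoffmanSpan_le_of_relation (M : MotivicMZV) [IsDomain M.H]
    {N : ℕ} (l : {u : List ℕ // IsHoffman u} →₀ ℚ) (hl : l ≠ 0)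
    (hwt : ∀ u ∈ l.support, weight u.1 ≤ N)
    (hrel : (l.sum fun u c => (c : ℝ) * multipleZeta u.1) = 0) (K : ℕ) (hK : N ≤ K) :
    Module.finrank ℚ ↥(⨆ k ∈ Finset.range (K + 1), hoffmanSpan k) ≤
      (∑ k ∈ Finset.range (K + 1), zagierDim k) -
        (∑ k ∈ Finset.range (K - N + 1), zagierDim k) := by
  have hgr : iSupIndep M.Hw := stub_gradingIndep M
  have hdim : ∀ N, Module.finrank ℚ (M.Hw N) = zagierDim N := fun N => (stub_hoffmanBasis M N).1
  have hhoff : ∀ N, Submodule.span ℚ (Set.range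
      fun w : {w : List ℕ // IsHoffman w ∧ weight w = N} => M.J (rho w.1.reverse)) = M.Hw N :=
    fun N => (stub_hoffmanBasis M N).2
  obtain ⟨R, hR, hRN, hper⟩ := stub_kernelElement M hgr hdim hhoff l hl hwt hrel
  exact stub_finrankLeOfKernelElement M (stub_finrankFiltered M hgr hdim hhoff) hR hRN hper K hK

/-- **Contrapositive: the counting statement gives independence.** If every non-trivial
`ℚ`-relation of weight `≤ N` among real Hoffman values caps `dim ⨆_{k≤K} hoffmanSpan k` by
`d_{≤K} - d_{≤K-N}` for all `K ≥ N` (`hamp`), then the asymptotic count `hdense` makes the real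
Hoffman values `ℚ`-linearly independent: a dependence is a finitely supported `l ≠ 0` with
`∑ l(u) ζ(u) = 0` (`linearIndependent_iff`, `Finsupp.linearCombination_apply`, `Rat.smul_def`);
take `N =` the largest weight on `l.support`. -/
theorem crux_of_amplification
    (hamp : ∀ (N : ℕ) (l : {u : List ℕ // IsHoffman u} →₀ ℚ), l ≠ 0 →
      (∀ u ∈ l.support, weight u.1 ≤ N) →
      (l.sum fun u c => (c : ℝ) * multipleZeta u.1) = 0 →
      ∀ K, N ≤ K → Module.finrank ℚ ↥(⨆ k ∈ Finset.range (K + 1), hoffmanSpan k) ≤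
        (∑ k ∈ Finset.range (K + 1), zagierDim k) -
          (∑ k ∈ Finset.range (K - N + 1), zagierDim k))
    (hdense : ∀ N : ℕ, ∃ K : ℕ, N ≤ K ∧
      (∑ k ∈ Finset.range (K + 1), zagierDim k) -
          (∑ k ∈ Finset.range (K - N + 1), zagierDim k) <
        Module.finrank ℚ ↥(⨆ k ∈ Finset.range (K + 1), hoffmanSpan k)) :
    LinearIndependent ℚ (fun u : {u : List ℕ // IsHoffman u} => multipleZeta u.1) := by
  rw [linearIndependent_iff]
  intro l hl0
  by_contra hl
  set N : ℕ := l.support.sup fun u => weight u.1 with hN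
  have hwt : ∀ u ∈ l.support, weight u.1 ≤ N := fun u hu =>
    Finset.le_sup (f := fun u : {u : List ℕ // IsHoffman u} => weight u.1) hu
  have hrel : (l.sum fun u c => (c : ℝ) * multipleZeta u.1) = 0 := by
    rw [Finsupp.linearCombination_apply] at hl0
    simpa only [Rat.smul_def] using hl0
  obtain ⟨K, hK, hlt⟩ := hdense N
  exact absurd (hamp N l hl hwt hrel K hK) (not_le.mpr hlt)

/-- **Independence from the counting statement over a given motivic structure**
(`crux_of_density` of the card): for Brown's motivic MZVs `M` with `H` a domain, the asymptotic
Hoffman count with slack `∀ N, ∃ K ≥ N, d_{≤K} - d_{≤K-N} < dim_ℚ ⨆_{k≤K} hoffmanSpan k` implies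
the `ℚ`-linear independence of all real Hoffman values `ζ(u)`, `u ∈ {2,3}^×`. -/
theorem crux_of_density (M : MotivicMZV) [IsDomain M.H]
    (hdense : ∀ N : ℕ, ∃ K : ℕ, N ≤ K ∧
      (∑ k ∈ Finset.range (K + 1), zagierDim k) -
          (∑ k ∈ Finset.range (K - N + 1), zagierDim k) <
        Module.finrank ℚ ↥(⨆ k ∈ Finset.range (K + 1), hoffmanSpan k)) :
    LinearIndependent ℚ (fun u : {u : List ℕ // IsHoffman u} => multipleZeta u.1) :=
  crux_of_amplification
    (fun _ l hl hwt hrel K hK => finrank_hoffmanSpan_le_of_relation M l hl hwt hrel K hK) hdense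

/-- **`HoffmanIndependence` from Brown's motivic input and the counting statement `C⁺`**
(CONDITIONAL — the line's transfer with the conclusion by name): if Brown's motivic MZVs exist
with `H` an integral domain (Brown 2012 §2 with Deligne–Goncharov 2005; `H ≅ 𝒰` a polynomial
algebra — theorem in print, XL formalisation debt) and the real Hoffman values satisfy the
asymptotic count with slack `C⁺` (OPEN; implied by the crux with `K = N`), then
`Theses.LinRedNormalForm.HoffmanIndependence` holds. -/
theorem hoffmanIndependence_of_denseCount : (∃ M : MotivicMZV, IsDomain M.H) →
    (∀ N : ℕ, ∃ K : ℕ, N ≤ K ∧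
      (∑ k ∈ Finset.range (K + 1), zagierDim k) -
          (∑ k ∈ Finset.range (K - N + 1), zagierDim k) <
        Module.finrank ℚ ↥(⨆ k ∈ Finset.range (K + 1), hoffmanSpan k)) →
    HoffmanIndependence := by
  rintro ⟨M, hdom⟩ hdense
  exact crux_of_density M hdense

/-- **Converse (the easy direction): the crux implies the counting statement `C⁺`**, with `K = N`:
under `HoffmanIndependence` the real Hoffman values of weight `≤ N` are `d_{≤N}` linearly
independent vectors of `⨆_{k≤N} hoffmanSpan k`, so its dimension is `≥ d_{≤N} > d_{≤N} - d_{≤0}`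
(`d_0 = 1`). Recorded to document that `C⁺` is crux-EQUIVALENT (the line reformulates the crux; it
does not weaken it). -/
theorem denseCount_of_hoffmanIndependence (h : HoffmanIndependence) :
    ∀ N : ℕ, ∃ K : ℕ, N ≤ K ∧
      (∑ k ∈ Finset.range (K + 1), zagierDim k) -
          (∑ k ∈ Finset.range (K - N + 1), zagierDim k) <
        Module.finrank ℚ ↥(⨆ k ∈ Finset.range (K + 1), hoffmanSpan k) := by
  intro N
  refine ⟨N, le_rfl, ?_⟩
  have h' : LinearIndependent ℚ (fun u : {u : List ℕ // IsHoffman u} => multipleZeta u.1) := h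
  -- the Hoffman words of weight `≤ N`, a finite type of cardinality `d_{≤N}`
  haveI : ∀ k, Finite {w : List ℕ // IsHoffman w ∧ weight w = k} := fun k => finite_hoffman k
  letI : ∀ k, Fintype {w : List ℕ // IsHoffman w ∧ weight w = k} := fun k => Fintype.ofFinite _
  let ι := Σ k : Fin (N + 1), {w : List ℕ // IsHoffman w ∧ weight w = (k : ℕ)}
  -- their values lie in the filtered span …
  have hmem : ∀ i : ι, multipleZeta i.2.1 ∈ ⨆ k ∈ Finset.range (N + 1), hoffmanSpan k := by
    rintro ⟨k, ⟨w, hw, hwk⟩⟩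
    have h1 : multipleZeta w ∈ hoffmanSpan (k : ℕ) :=
      Submodule.subset_span ⟨w, hw, hwk, rfl⟩
    exact (le_biSup hoffmanSpan (Finset.mem_range.2 k.2)) h1
  -- … and are linearly independent (an instance of the crux, along an injective reindexing);
  -- the family is kept in the composed form `(u ↦ ζ(u)) ∘ e` (a bare `fun i => ζ(i.2.1)` ascription
  -- sends the unifier into a `whnf` timeout on `multipleZeta`)
  have hinj : Function.Injective fun i : ι => (⟨i.2.1, i.2.2.1⟩ : {u : List ℕ // IsHoffman u}) := by
    rintro ⟨k, ⟨w, hw, hwk⟩⟩ ⟨k', ⟨w', hw', hwk'⟩⟩ hh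
    simp only [Subtype.mk.injEq] at hh
    subst hh
    have : k = k' := Fin.ext (hwk.symm.trans hwk')
    subst this
    rfl
  have hli : LinearIndependent ℚ ((fun u : {u : List ℕ // IsHoffman u} => multipleZeta u.1) ∘
      fun i : ι => (⟨i.2.1, i.2.2.1⟩ : {u : List ℕ // IsHoffman u})) := h'.comp _ hinj
  have hspan : Submodule.span ℚ (Set.range ((fun u : {u : List ℕ // IsHoffman u} =>
      multipleZeta u.1) ∘ fun i : ι => (⟨i.2.1, i.2.2.1⟩ : {u : List ℕ // IsHoffman u}))) ≤
      ⨆ k ∈ Finset.range (N + 1), hoffmanSpan k :=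
    Submodule.span_le.2 (Set.range_subset_iff.2 fun i => hmem i)
  -- finite-dimensionality of the filtered span (each `hoffmanSpan k` is spanned by finitely many values)
  haveI : ∀ k, FiniteDimensional ℚ (hoffmanSpan k) := fun k => by
    have hs : {x : ℝ | ∃ s, IsHoffman s ∧ weight s = k ∧ x = multipleZeta s} =
        Set.range fun w : {w : List ℕ // IsHoffman w ∧ weight w = k} => multipleZeta w.1 := by
      ext x
      simp only [Set.mem_setOf_eq, Set.mem_range, Subtype.exists, exists_prop]
      constructor
      · rintro ⟨s, hs, hw, rfl⟩; exact ⟨s, ⟨hs, hw⟩, rfl⟩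
      · rintro ⟨s, ⟨hs, hw⟩, rfl⟩; exact ⟨s, hs, hw, rfl⟩
    unfold hoffmanSpan
    rw [hs]
    exact FiniteDimensional.span_of_finite ℚ (Set.finite_range _)
  haveI : FiniteDimensional ℚ ↥(⨆ k ∈ Finset.range (N + 1), hoffmanSpan k) := by
    rw [← Finset.sup_eq_iSup]
    infer_instance
  -- count
  have hcard : Fintype.card ι = ∑ k ∈ Finset.range (N + 1), zagierDim k := by
    rw [Fintype.card_sigma, Finset.sum_range]
    refine Finset.sum_congr rfl fun k _ => ?_
    rw [zagierDim_eq_card_hoffman_holds, Nat.card_eq_fintype_card]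
  have hle : ∑ k ∈ Finset.range (N + 1), zagierDim k ≤
      Module.finrank ℚ ↥(⨆ k ∈ Finset.range (N + 1), hoffmanSpan k) := by
    rw [← hcard, ← finrank_span_eq_card hli]
    exact Submodule.finrank_mono hspan
  have h0 : ∑ k ∈ Finset.range (N - N + 1), zagierDim k = 1 := by
    simp [zagierDim]
  rw [h0]
  have hpos : 0 < ∑ k ∈ Finset.range (N + 1), zagierDim k :=
    lt_of_lt_of_le (by simp [zagierDim]) (Finset.single_le_sum (f := zagierDim)
      (fun _ _ => Nat.zero_le _) (Finset.mem_range.2 (Nat.succ_pos N)))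
  omega

end Summit.KontsevichZagierPeriods.LinRedNormalForm.HoffmanIndependence
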